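import Summits.RiemannHypothesis.RiemannHypothesis.Theorems.TiltedLandingLaw421R3SinkBdry

/-!
# «SinkConePos» v1 — STRICT-CONE POSITIVITY of the pair form `pairCForm` (`c(u) = −Im K_u(w)`) on the maximal far strip
(C1 desk, rh-idea-5 g40; files-only; SUPPORT, K only; invited (CA999)(1) second half «`pairCForm_near_pos`-type strict-cone positivity … one small K image
on #1261», queued (iii) by (CA1015)(1) — consumer: C3's column / lid certificates; the homogeneity half is 118 «SinkScale» = #1270)

ONE import: TREE #1261 «SinkBdry» (110).  Namespace `RhW08.SinkConePos`; nothing of 102/110 re-declared.  (K) only, asserts no law.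
* §1 THE PRODUCT IDENTITY `c · E₋ · E₊ = 2t·((δ − ξ)² + t² − b²)`, `E∓ = (δ − ξ)² + (t ∓ b)²` (`pairCForm_mul`; general `δ t ξ b`; 120 «K1Near»'s
  `RhW08.K1NearColumnLink.pairCForm_near_mul` / `_near_pos` (R = 2, ξ = 1) and C3's far-column twins (ξ = −1) are special cases BY NAME), and the POSITIVITY CRITERION
  `0 < t → b² < (δ − ξ)² + t² → 0 < pairCForm δ t ξ b` (`pairCForm_pos`; the strict hypothesis itself excludes both poles, `pairDenom_pos_sub` /
  `pairDenom_pos_add`), with the converse off the poles (`pairCForm_pos_iff`).  Geometrically: `c(u) > 0` iff the child `w` lies OUTSIDE the circle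
  through `u, ū` centred at the real point `Re u`.
* §2 THE CONE IN CLOSED FORM: for `0 ≤ R`, 102's `ConeChild` datum `|δ|·(R − |δ|) < t²` is `δ(R − δ) < t² ∧ −δ(R + δ) < t²`, i.e. `w` lies
  outside the two closed discs of radius `R/2` centred at `xv ± R/2` (`coneChild_abs_iff`, `coneChild_disc_right`, `coneChild_disc_left`).
* §3 POSITIVITY ON THE STRIP for a strict cone child IN THE NEAR WINDOW (`|δ| ≤ R/2`, `0 < t`): `0 < pairCForm δ t ξ b` whenever `R/2 ≤ |ξ|`, `|b| ≤ R/2`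
  (`pairCForm_pos_strip`), hence on the four boundary pieces of 110's `BdryDomForm` (`pairCForm_pos_col_right/left`, `pairCForm_pos_lid_right/left`) and at the two
  top corners dividing `cornerSigmaForm` (`pairCForm_pos_corner_right/left`).  The near-window side condition is NECESSARY: with `δ = ξ = 3R`, `t = 2R/5`, `b = R/2`
  the cone datum holds (`|δ|(R − |δ|) < 0`) but `c = −10/R + 10/(9R) < 0` (kernel witness at `R = 10`: `strip_pos_needs_window`).
* §4 COMPLEX READ-BACK certifying 102's `ConeChild` docstring («i.e. `c(u) > 0` on the whole maximal strip») in its true scope: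
  `|Re w − xv| ≤ R/2 → 0 < Im w → ConeChild xv R w → MaxStrip xv R u → 0 < farPairC w u` (`farPairC_pos_of_coneChild`, via 110's `farPairC_eq`; also `_bdry`).
* §5 CONSEQUENCES: the multiplier enters MONOTONICALLY — `KernelDom`/`KernelDomBdry`/`BdryDomForm` with `σ` imply the same with any `σ' ≥ σ` on cone children
  (`kernelDom_mono`, `kernelDomBdry_mono`, `bdryDomForm_mono`) — and `σ*` IS THE LEAST boundary multiplier: `BdryDomForm R δ t h y0 σ → cornerSigmaForm R δ t h y0 ≤ σ`
  (`cornerSigmaForm_le_of_bdryDomForm`), so 102/113's corner dominance is the SHARP form of (K∂) for the two-point family.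
LEVEL: SUPPORT (K).  No `sorry`.  Nothing here bears on the truth of RH; RH is not proved; ⟨33346⟩/⟨33347⟩ OPEN;
`CornerDominanceRSig` / `CertificatesExistSig` OPEN; checked ≠ keyed ≠ landed ≠ proved.
-/

noncomputable section

open Complex
open RhW08.SinkTemplate
open RhW08.SinkBdry

namespace RhW08.SinkConePos

/-! ## §1 The product identity and the positivity criterion -/

/-- Off the criterion's boundary the lower denominator is positive: `b² < (δ − ξ)² + t² → 0 < (δ − ξ)² + (t − b)²`
(at a zero, `δ = ξ` and `t = b`, so `b² = t²`). -/
theorem pairDenom_pos_sub {δ t ξ b : ℝ} (h : b ^ 2 < (δ - ξ) ^ 2 + t ^ 2) : 0 < (δ - ξ) ^ 2 + (t - b) ^ 2 := by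
  rcases (sq_nonneg (δ - ξ)).lt_or_eq with hA | hA
  · exact add_pos_of_pos_of_nonneg hA (sq_nonneg _)
  · have htb : t - b ≠ 0 := by
      intro e
      rw [← hA, sub_eq_zero.1 e] at h
      linarith
    rw [← hA, zero_add]
    positivity

/-- The same for the upper denominator: `b² < (δ − ξ)² + t² → 0 < (δ − ξ)² + (t + b)²` (at a zero, `δ = ξ` and `t = −b`). -/
theorem pairDenom_pos_add {δ t ξ b : ℝ} (h : b ^ 2 < (δ - ξ) ^ 2 + t ^ 2) : 0 < (δ - ξ) ^ 2 + (t + b) ^ 2 := by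
  rcases (sq_nonneg (δ - ξ)).lt_or_eq with hA | hA
  · exact add_pos_of_pos_of_nonneg hA (sq_nonneg _)
  · have htb : t + b ≠ 0 := by
      intro e
      have eb : b = -t := by linarith
      rw [← hA, eb, neg_sq] at h
      linarith
    rw [← hA, zero_add]
    positivity

/-- ★ THE PRODUCT IDENTITY (general `δ t ξ b`, both denominators nonzero): `pairCForm δ t ξ b · (E₋ · E₊) = 2t·((δ − ξ)² + t² − b²)`,
`E₋ = (δ − ξ)² + (t − b)²`, `E₊ = (δ − ξ)² + (t + b)²`. -/
theorem pairCForm_mul (δ t ξ b : ℝ) (hm : (δ - ξ) ^ 2 + (t - b) ^ 2 ≠ 0) (hp : (δ - ξ) ^ 2 + (t + b) ^ 2 ≠ 0) :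
    pairCForm δ t ξ b * (((δ - ξ) ^ 2 + (t - b) ^ 2) * ((δ - ξ) ^ 2 + (t + b) ^ 2)) = 2 * t * ((δ - ξ) ^ 2 + t ^ 2 - b ^ 2) := by
  unfold pairCForm
  field_simp
  ring

/-- ★ POSITIVITY CRITERION: for a child in the upper half plane (`0 < t`), `b² < (δ − ξ)² + t²` gives `0 < pairCForm δ t ξ b` — no side condition (the strict
hypothesis excludes both poles).  C3 g56's `pairCForm_near_pos` / `pairCForm_far_pos` / `pairCForm_near_corner_pos` (R = 2) are special cases. -/
theorem pairCForm_pos {δ t ξ b : ℝ} (ht : 0 < t) (h : b ^ 2 < (δ - ξ) ^ 2 + t ^ 2) : 0 < pairCForm δ t ξ b := by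
  have hm := pairDenom_pos_sub h
  have hp := pairDenom_pos_add h
  have hE : 0 < ((δ - ξ) ^ 2 + (t - b) ^ 2) * ((δ - ξ) ^ 2 + (t + b) ^ 2) := mul_pos hm hp
  have hnum : 0 < 2 * t * ((δ - ξ) ^ 2 + t ^ 2 - b ^ 2) := by
    have : 0 < (δ - ξ) ^ 2 + t ^ 2 - b ^ 2 := by linarith
    positivity
  rw [← pairCForm_mul δ t ξ b hm.ne' hp.ne'] at hnum
  exact (mul_pos_iff_of_pos_right hE).1 hnum

/-- The criterion is sharp off the poles: for `0 < t` and both denominators nonzero, `0 < pairCForm δ t ξ b ↔ b² < (δ − ξ)² + t²`. -/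
theorem pairCForm_pos_iff {δ t ξ b : ℝ} (ht : 0 < t) (hm : 0 < (δ - ξ) ^ 2 + (t - b) ^ 2) (hp : 0 < (δ - ξ) ^ 2 + (t + b) ^ 2) :
    0 < pairCForm δ t ξ b ↔ b ^ 2 < (δ - ξ) ^ 2 + t ^ 2 := by
  refine ⟨fun hc => ?_, pairCForm_pos ht⟩
  have hE : 0 < ((δ - ξ) ^ 2 + (t - b) ^ 2) * ((δ - ξ) ^ 2 + (t + b) ^ 2) := mul_pos hm hp
  have hprod : 0 < 2 * t * ((δ - ξ) ^ 2 + t ^ 2 - b ^ 2) := by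
    rw [← pairCForm_mul δ t ξ b hm.ne' hp.ne']
    exact mul_pos hc hE
  have h2t : 0 < 2 * t := by positivity
  have := (mul_pos_iff_of_pos_left h2t).1 hprod
  linarith

/-! ## §2 The cone in closed form -/

/-- ★ 102's cone datum in closed form (`0 ≤ R`): `|δ|·(R − |δ|) < t² ↔ δ(R − δ) < t² ∧ −δ(R + δ) < t²`. -/
theorem coneChild_abs_iff {R δ t : ℝ} (hR : 0 ≤ R) : |δ| * (R - |δ|) < t ^ 2 ↔ δ * (R - δ) < t ^ 2 ∧ -δ * (R + δ) < t ^ 2 := by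
  rcases le_or_gt 0 δ with hδ | hδ
  · rw [abs_of_nonneg hδ]
    refine ⟨fun h => ⟨h, ?_⟩, fun h => h.1⟩
    nlinarith [mul_nonneg hδ hR]
  · rw [abs_of_neg hδ]
    have e : -δ * (R - -δ) = -δ * (R + δ) := by ring
    rw [e]
    refine ⟨fun h => ⟨?_, h⟩, fun h => h.2⟩
    nlinarith [mul_nonpos_iff.2 (Or.inr ⟨hδ.le, hR⟩)]

/-- The right disc: `w` outside the closed disc of radius `R/2` centred at `xv + R/2`, in the shape `pairCForm_pos` consumes at `ξ = R/2`. -/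
theorem coneChild_disc_right {R δ t : ℝ} (hR : 0 ≤ R) (hc : |δ| * (R - |δ|) < t ^ 2) : (R / 2) ^ 2 < (δ - R / 2) ^ 2 + t ^ 2 := by
  have h := ((coneChild_abs_iff hR).1 hc).1
  nlinarith

/-- The left disc: `w` outside the closed disc of radius `R/2` centred at `xv − R/2`, in the shape `pairCForm_pos` consumes at `ξ = −(R/2)`. -/
theorem coneChild_disc_left {R δ t : ℝ} (hR : 0 ≤ R) (hc : |δ| * (R - |δ|) < t ^ 2) : (R / 2) ^ 2 < (δ - -(R / 2)) ^ 2 + t ^ 2 := by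
  have h := ((coneChild_abs_iff hR).1 hc).2
  nlinarith

/-! ## §3 Positivity on the maximal strip for a strict cone child in the near window -/

/-- ★ STRIP POSITIVITY: a strict cone child (`|δ|·(R − |δ|) < t²`, `0 < t`) in the near window (`|δ| ≤ R/2`) has `0 < pairCForm δ t ξ b` at every point of the
maximal far strip `R/2 ≤ |ξ|`, `|b| ≤ R/2` (columns AND lids; `0 ≤ R` follows from `|b| ≤ R/2`). -/
theorem pairCForm_pos_strip {R δ t ξ b : ℝ} (ht : 0 < t) (hc : |δ| * (R - |δ|) < t ^ 2) (hδ : |δ| ≤ R / 2) (hξ : R / 2 ≤ |ξ|)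
    (hb : |b| ≤ R / 2) : 0 < pairCForm δ t ξ b := by
  have hR : 0 ≤ R := by linarith [abs_nonneg b]
  have hb2 : b ^ 2 ≤ (R / 2) ^ 2 := by
    have h1 := (abs_le.1 hb).1
    have h2 := (abs_le.1 hb).2
    nlinarith
  have hδ1 := (abs_le.1 hδ).1
  have hδ2 := (abs_le.1 hδ).2
  refine pairCForm_pos ht ?_
  rcases le_abs'.1 hξ with hξ | hξ
  · -- left half of the strip: `ξ ≤ −R/2 ≤ δ`
    have hl := coneChild_disc_left hR hc
    have hmono : (δ - -(R / 2)) ^ 2 ≤ (δ - ξ) ^ 2 := by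
      nlinarith [mul_nonneg (by linarith : (0 : ℝ) ≤ -ξ - R / 2) (by linarith : (0 : ℝ) ≤ 2 * δ - ξ + R / 2)]
    linarith
  · -- right half of the strip: `δ ≤ R/2 ≤ ξ`
    have hr := coneChild_disc_right hR hc
    have hmono : (δ - R / 2) ^ 2 ≤ (δ - ξ) ^ 2 := by
      nlinarith [mul_nonneg (by linarith : (0 : ℝ) ≤ ξ - R / 2) (by linarith : (0 : ℝ) ≤ ξ + R / 2 - 2 * δ)]
    linarith

/-- The near-window condition in `pairCForm_pos_strip` is NECESSARY: at `R = 10`, `δ = ξ = 30`, `t = 4`, `b = 5` the cone datum holds (`|δ|(R − |δ|) = −600`),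
the point lies on the strip's upper lid, and `c = −1 + 1/9 < 0`. -/
theorem strip_pos_needs_window :
    ∃ R δ t ξ b : ℝ, 0 < R ∧ 0 < t ∧ |δ| * (R - |δ|) < t ^ 2 ∧ R / 2 ≤ |ξ| ∧ |b| ≤ R / 2 ∧ pairCForm δ t ξ b < 0 :=
  ⟨10, 30, 4, 30, 5, by norm_num, by norm_num, by norm_num [abs_of_pos], by norm_num [abs_of_pos], by norm_num [abs_of_pos],
    by norm_num [pairCForm]⟩

/-- Right inner column (`ξ = R/2`, `|b| ≤ R/2`): `0 < c` — the first `BdryDomForm` piece's multiplier side is positive.  Only `0 ≤ R`, the cone and `0 < t` are used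
here (no near-window condition on this piece). -/
theorem pairCForm_pos_col_right {R δ t b : ℝ} (hR : 0 ≤ R) (ht : 0 < t) (hc : |δ| * (R - |δ|) < t ^ 2) (hb1 : -(R / 2) ≤ b) (hb2 : b ≤ R / 2) :
    0 < pairCForm δ t (R / 2) b := by
  refine pairCForm_pos ht ?_
  have hr := coneChild_disc_right hR hc
  nlinarith

/-- Left inner column (`ξ = −R/2`, `|b| ≤ R/2`): `0 < c`. -/
theorem pairCForm_pos_col_left {R δ t b : ℝ} (hR : 0 ≤ R) (ht : 0 < t) (hc : |δ| * (R - |δ|) < t ^ 2) (hb1 : -(R / 2) ≤ b) (hb2 : b ≤ R / 2) :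
    0 < pairCForm δ t (-(R / 2)) b := by
  refine pairCForm_pos ht ?_
  have hl := coneChild_disc_left hR hc
  nlinarith

/-- Right upper lid ray (`b = R/2`, `R/2 ≤ ξ`) for a child with `δ ≤ R/2`: `0 < c`. -/
theorem pairCForm_pos_lid_right {R δ t ξ : ℝ} (hR : 0 ≤ R) (ht : 0 < t) (hc : |δ| * (R - |δ|) < t ^ 2) (hδ : δ ≤ R / 2) (hξ : R / 2 ≤ ξ) :
    0 < pairCForm δ t ξ (R / 2) := by
  refine pairCForm_pos ht ?_
  have hr := coneChild_disc_right hR hc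
  have hmono : (δ - R / 2) ^ 2 ≤ (δ - ξ) ^ 2 := by
    nlinarith [mul_nonneg (by linarith : (0 : ℝ) ≤ ξ - R / 2) (by linarith : (0 : ℝ) ≤ ξ + R / 2 - 2 * δ)]
  linarith

/-- Left upper lid ray (`b = R/2`, `R/2 ≤ −ξ`) for a child with `−R/2 ≤ δ`: `0 < c`. -/
theorem pairCForm_pos_lid_left {R δ t ξ : ℝ} (hR : 0 ≤ R) (ht : 0 < t) (hc : |δ| * (R - |δ|) < t ^ 2) (hδ : -(R / 2) ≤ δ) (hξ : R / 2 ≤ -ξ) :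
    0 < pairCForm δ t ξ (R / 2) := by
  refine pairCForm_pos ht ?_
  have hl := coneChild_disc_left hR hc
  have hmono : (δ - -(R / 2)) ^ 2 ≤ (δ - ξ) ^ 2 := by
    nlinarith [mul_nonneg (by linarith : (0 : ℝ) ≤ -ξ - R / 2) (by linarith : (0 : ℝ) ≤ 2 * δ - ξ + R / 2)]
  linarith

/-- Right top corner (`ξ = b = R/2`): the first denominator of `cornerSigmaForm` is positive on a strict cone child. -/
theorem pairCForm_pos_corner_right {R δ t : ℝ} (hR : 0 ≤ R) (ht : 0 < t) (hc : |δ| * (R - |δ|) < t ^ 2) :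
    0 < pairCForm δ t (R / 2) (R / 2) :=
  pairCForm_pos_col_right hR ht hc (by linarith) le_rfl

/-- Left top corner (`ξ = −R/2`, `b = R/2`): the second denominator of `cornerSigmaForm` is positive on a strict cone child. -/
theorem pairCForm_pos_corner_left {R δ t : ℝ} (hR : 0 ≤ R) (ht : 0 < t) (hc : |δ| * (R - |δ|) < t ^ 2) :
    0 < pairCForm δ t (-(R / 2)) (R / 2) :=
  pairCForm_pos_col_left hR ht hc (by linarith) le_rfl

/-! ## §4 Complex read-back: `c(u) > 0` on the maximal strip -/

/-- The boundary of the maximal strip lies in the maximal strip. -/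
theorem maxStrip_of_bdry {xv R : ℝ} {u : ℂ} (hu : MaxStripBdry xv R u) : MaxStrip xv R u := by
  rcases hu with ⟨h1, h2⟩ | ⟨h1, h2⟩
  · exact ⟨h1.symm.le, h2⟩
  · exact ⟨h1, h2.le⟩

/-- ★ 102's `ConeChild` docstring, certified in its true scope: a strict cone child `w` IN THE NEAR WINDOW (`|Re w − xv| ≤ R/2`, `0 < Im w`) has
`0 < c(u) = farPairC w u` at every `u` of the maximal far strip.  (Without the near-window condition this fails deep in the strip, see the module docstring.) -/
theorem farPairC_pos_of_coneChild (xv R : ℝ) (w u : ℂ) (hw : |w.re - xv| ≤ R / 2) (ht : 0 < w.im) (hc : ConeChild xv R w) (hu : MaxStrip xv R u) :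
    0 < farPairC w u := by
  rw [farPairC_eq w u xv]
  exact pairCForm_pos_strip ht hc hw hu.1 hu.2

/-- The same on the boundary of the maximal strip (the (K∂) locus). -/
theorem farPairC_pos_of_coneChild_bdry (xv R : ℝ) (w u : ℂ) (hw : |w.re - xv| ≤ R / 2) (ht : 0 < w.im) (hc : ConeChild xv R w)
    (hu : MaxStripBdry xv R u) : 0 < farPairC w u :=
  farPairC_pos_of_coneChild xv R w u hw ht hc (maxStrip_of_bdry hu)

/-! ## §5 Consequences: monotonicity in the multiplier; `σ*` is the least boundary multiplier -/

/-- (K) is MONOTONE in `σ` on a cone child in the near window (any cut family): domination with `σ` gives domination with every `σ' ≥ σ`. -/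
theorem kernelDom_mono {κ : Type} [Fintype κ] (xv R : ℝ) (cs : κ → Cut) (w : ℂ) {σ σ' : ℝ} (hw : |w.re - xv| ≤ R / 2) (ht : 0 < w.im)
    (hc : ConeChild xv R w) (hσ : σ ≤ σ') (hK : KernelDom xv R cs w σ) : KernelDom xv R cs w σ' := by
  intro u hu
  have hcu := farPairC_pos_of_coneChild xv R w u hw ht hc hu
  exact (hK u hu).trans (mul_le_mul_of_nonneg_right hσ hcu.le)

/-- (K∂) is MONOTONE in `σ` on a cone child in the near window (any cut family). -/
theorem kernelDomBdry_mono {κ : Type} [Fintype κ] (xv R : ℝ) (cs : κ → Cut) (w : ℂ) {σ σ' : ℝ} (hw : |w.re - xv| ≤ R / 2) (ht : 0 < w.im)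
    (hc : ConeChild xv R w) (hσ : σ ≤ σ') (hK : KernelDomBdry xv R cs w σ) : KernelDomBdry xv R cs w σ' := by
  intro u hu
  have hcu := farPairC_pos_of_coneChild_bdry xv R w u hw ht hc hu
  exact (hK u hu).trans (mul_le_mul_of_nonneg_right hσ hcu.le)

/-- `BdryDomForm` is MONOTONE in `σ` for a strict cone child in the near window (`0 ≤ R`, `0 < t`, `|δ| ≤ R/2`). -/
theorem bdryDomForm_mono {R δ t h y0 σ σ' : ℝ} (hR : 0 ≤ R) (ht : 0 < t) (hc : |δ| * (R - |δ|) < t ^ 2) (hδ : |δ| ≤ R / 2) (hσ : σ ≤ σ')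
    (hB : BdryDomForm R δ t h y0 σ) : BdryDomForm R δ t h y0 σ' := by
  have hδ1 := (abs_le.1 hδ).1
  have hδ2 := (abs_le.1 hδ).2
  rcases hB with ⟨h1, h2, h3, h4⟩
  refine ⟨fun b hb0 hb1 => ?_, fun b hb0 hb1 => ?_, fun ξ hξ => ?_, fun ξ hξ => ?_⟩
  · exact (h1 b hb0 hb1).trans
      (mul_le_mul_of_nonneg_right hσ (pairCForm_pos_col_right hR ht hc (by linarith) hb1).le)
  · exact (h2 b hb0 hb1).trans
      (mul_le_mul_of_nonneg_right hσ (pairCForm_pos_col_left hR ht hc (by linarith) hb1).le)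
  · exact (h3 ξ hξ).trans (mul_le_mul_of_nonneg_right hσ (pairCForm_pos_lid_right hR ht hc hδ2 hξ).le)
  · exact (h4 ξ hξ).trans (mul_le_mul_of_nonneg_right hσ (pairCForm_pos_lid_left hR ht hc hδ1 hξ).le)

/-- ★ `σ*` IS THE LEAST BOUNDARY MULTIPLIER: on a strict cone child (`0 ≤ R`, `0 < t`), boundary domination with ANY `σ` forces `cornerSigmaForm R δ t h y0 ≤ σ`
(read the two column inequalities at the top corners `b = R/2` and divide by the positive corner values of `c`).  So corner dominance (`σ = σ*`) is the sharp
form of (K∂) for the two-point family. -/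
theorem cornerSigmaForm_le_of_bdryDomForm {R δ t h y0 σ : ℝ} (hR : 0 ≤ R) (ht : 0 < t) (hc : |δ| * (R - |δ|) < t ^ 2)
    (hB : BdryDomForm R δ t h y0 σ) : cornerSigmaForm R δ t h y0 ≤ σ := by
  have hR2 : 0 ≤ R / 2 := by linarith
  have hcr := pairCForm_pos_corner_right hR ht hc
  have hcl := pairCForm_pos_corner_left hR ht hc
  have h1 := hB.1 (R / 2) hR2 le_rfl
  have h2 := hB.2.1 (R / 2) hR2 le_rfl
  unfold cornerSigmaForm
  exact max_le ((div_le_iff₀ hcr).2 h1) ((div_le_iff₀ hcl).2 h2)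

end RhW08.SinkConePos

end
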